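import Literature.NumberTheory.LFunctions.ZetaZeroSumsPsiWeightHigh
import Literature.NumberTheory.LFunctions.ExplicitFormulaPsiErrorExplicit
import HarnessLib

/-!
# RH-FREE — Fiori–Kadiri–Swidinsky 2023, §3.1–3.2 and §4 eq. (4.1) at the point `x = x₀`: `|ψ(x) − x|/x ≤ ε₁ + ε₂ + ε₃ + ε₄` assembled from Props 3.4, 3.6, 3.8 and Cor. 3.12 («nothing here bears on the truth of RH»)

Topic `Literature/NumberTheory/LFunctions` (RH literature-typing tranche 1, L4 "explicit zero
statistics", gen 5). Label **RH-FREE**. One definition (`ε₁`) and THEOREMS; no named facts. Nothing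
here bears on the truth of RH. Item/equation numbers are those of the compiled arXiv v3
(theorem-like environments share one counter).

Fiori–Kadiri–Swidinsky, J. Math. Anal. Appl. 527 (2023) 127426 = arXiv:2204.02588v3.

* **§3.1 Prop. 3.4 with §3.2 eqs. (3.5)–(3.6)** (PROVED, `FioriKadiriSwidinsky2023_prop34_zeroSumPsi'`):
  for `x > e^{50}` and `3 log x < T < √x/3`,
  `|ψ(x) − x| ≤ (Σ₀¹(x,T) + ε₁(x,T)) x`, `ε₁(x,T) = 2 log²x/T` (eq. (3.4), `FKS2023.ε₁`), where
  `Σ₀¹(x,T) = 2Σ_{0<γ≤T} m(ρ) x^{β−1}/γ` (`FKS2023.zeroSumPsi 0 1`) — from the tree's Dudek-shape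
  consequence `CullyHugillJohnston2023_table4'.dudek_shape` of the NAMED FACT
  `CullyHugillJohnston2023_table4'` (Cully-Hugill–Johnston 2023, Thm. 1.2/Table 4, the input FKS use,
  Rem. 3.3; the corrected-domain typing `x ≥ e^X` of 2026-08-27 — the older `CullyHugillJohnston2023_table4`
  is refutable as typed and no theorem here takes it any more)
  and `|Σ_{|γ|≤T} m x^ρ/ρ| ≤ Σ_{|γ|≤T} m x^β/|γ| = x Σ₀¹(x,T)`
  (`norm_zetaZeroSumTrunc_le_zeroSumPsi`: conjugate pairs, `|ρ| ≥ |γ|`); and the split (3.6)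
  `Σ₀¹ = Σ₀^{σ₁} + Σ_{σ₁}^{σ₂} + Σ_{σ₂}^1` (`FKS2023.zeroSumPsi_add`).
* **§4, eq. (4.1) at `x = x₀`** (PROVED, `FioriKadiriSwidinsky2023_eq41'`): combining the above with
  Prop. 3.6 (`FioriKadiriSwidinsky2023_prop32`), Prop. 3.8 (`FioriKadiriSwidinsky2023_prop33`) and
  Cor. 3.12 (`FioriKadiriSwidinsky2023_cor312`):
  `|ψ(x) − x| ≤ (ε₁(x,T) + ε₂(x,σ₁,T₀,T) + ε₃(x,σ₁,σ₂,N,T) + ε₄(x,σ₂,K,T)) · x`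
  for every admissible parameter choice (`x > e^{50}`, `3 log x < T < √x/3`, `T` above the heights
  `H^{(n)}` and `t₀(σ₂,x)`, `5/8 ≤ σ₁ < σ₂ ≤ 1`, `N ≥ 2`, `K ≥ 1`, a row `(T₀,S₀)` of Table 1), given
  the NAMED FACTS `CullyHugillJohnston2023_table4'`, `FioriKadiriSwidinsky2023_table2` (= Table 1 of
  arXiv v3), `platt_trudgian_numerical_rh`, and, as hypotheses, a classical zero-free region with
  constant `R` (e.g. the tree's `zero_free_region_mossinghoff_trudgian_yang`), an `N(T)` error bound
  `b₁ log t + b₂ log log t + b₃` (e.g. the tree's proved `abs_count_sub_countMain_le_backlund`) and a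
  (ZDB) family on `[σ₁, σ₂]` (e.g. the facts `FioriKadiriSwidinsky2023_table6`). SCOPE: this is the
  printed `E_ψ(x₀) ≤ ε(x₀, σ₂, c, N, K)` with FKS's `σ₁ = 0.9`, `T = t₀(σ₂,x₀)^c` allowed to be any
  admissible values; the printed passage to ALL `x ≥ x₀` (monotonicity of the `ε_i` in `x`,
  Prop. 3.14) and the numerical Table of Theorem 1.1 are NOT formalized here (they stay the named
  fact `FioriKadiriSwidinsky2023_psi_table3` of `PrimeNumberTheoremErrorTermExplicit.lean`).

## References

* A. Fiori, H. Kadiri, J. Swidinsky, J. Math. Anal. Appl. 527 (2023) 127426 (arXiv:2204.02588v3),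
  §3.1 Prop. 3.4 eqs. (3.3)–(3.4), §3.2 eqs. (3.5)–(3.6), §4 eq. (4.1). [FioriKadiriSwidinsky2023]
* M. Cully-Hugill, D. R. Johnston, Int. J. Number Theory 19 (2023) 1205–1228, Thm. 1.2, Table 4.
  [CullyHugillJohnston2023]
* E. C. Titchmarsh, *The Theory of the Riemann Zeta-Function*, 2nd ed., §2.12 (conjugate symmetry
  of the zeros). [Titchmarsh1986]
-/

noncomputable section

open Complex Filter Set
open scoped Real Chebyshev

namespace Literature.NumberTheory.LFunctions

open SchoenfeldBound

namespace FKS2023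

/-- **`ε₁(x, T) = 2 log²x / T`** of eq. (3.4) (Prop. 3.4). [cite: FioriKadiriSwidinsky2023, Prop. 3.4 eq. (3.4)] -/
def ε₁ (x T : ℝ) : ℝ := 2 * Real.log x ^ 2 / T

end FKS2023

/-! ## The zero sum of the explicit formula against `Σ₀¹` -/

/-- `zerosBetween 0 T` is the counting box `zetaZeroBox 0 T` as a finset. [cite: Titchmarsh1986, §9.1] -/
theorem zerosBetween_zero_eq_toFinset (T : ℝ) :
    zerosBetween 0 T = (zetaZeroBox_finite 0 T).toFinset := by
  ext ρ
  rw [mem_zerosBetween le_rfl, Set.Finite.mem_toFinset]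
  simp only [zetaZeroBox, Set.mem_setOf_eq]

/-- **`|Σ_{|γ|≤T} m(ρ) x^ρ/ρ| ≤ x · Σ₀¹(x,T)`** (`x > 0`): `|x^ρ/ρ| = x^β/|ρ| ≤ x^β/|γ|`, and the
zeros `β ± iγ` pair up (conjugate symmetry, equal multiplicities), so the sum over `0 < |γ| ≤ T` is
twice the sum over `0 < γ ≤ T` — FKS (3.3)/(3.6): "`Σ_{|γ|<T} |x^{ρ−1}/ρ| ≤ 2Σ_{0<γ<T} x^{β−1}/γ`".
[cite: FioriKadiriSwidinsky2023, §3.2 eqs. (3.5)–(3.6)] [cite: Titchmarsh1986, §2.12] -/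
theorem norm_zetaZeroSumTrunc_le_zeroSumPsi {x : ℝ} (hx : 0 < x) (T : ℝ) :
    ‖zetaZeroSumTrunc x T‖ ≤ x * FKS2023.zeroSumPsi 0 1 x T := by
  classical
  set B := (zetaZeroBox_finite 0 T).toFinset with hB
  set f : ℂ → ℝ := fun ρ ↦ (riemannZetaZeroOrder ρ : ℝ) * (x ^ ρ.re / |ρ.im|) with hf
  have hW : (weilZeroIndex_finite T).toFinset = B ∪ B.image (starRingEnd ℂ) := by
    ext z
    simp only [hB, Set.Finite.mem_toFinset, Finset.mem_union, Finset.mem_image,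
      weilZeroIndex_eq_union, Set.mem_union, Set.mem_image]
  have hdisj : Disjoint B (B.image (starRingEnd ℂ)) := by
    rw [Finset.disjoint_left]
    intro z hz hz'
    rw [hB, Set.Finite.mem_toFinset] at hz
    obtain ⟨w, hw, rfl⟩ := Finset.mem_image.1 hz'
    rw [Set.Finite.mem_toFinset] at hw
    have h1 : 0 < (starRingEnd ℂ w).im := hz.2.2.2.1
    rw [Complex.conj_im] at h1
    linarith [hw.2.2.2.1]
  -- Step 1: the triangle inequality and `|ρ| ≥ |γ|`
  have h1 : ‖zetaZeroSumTrunc x T‖ ≤ ∑ ρ ∈ (weilZeroIndex_finite T).toFinset, f ρ := by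
    unfold zetaZeroSumTrunc
    refine (norm_sum_le _ _).trans (Finset.sum_le_sum fun ρ hρ ↦ ?_)
    rw [Set.Finite.mem_toFinset] at hρ
    obtain ⟨hz, -, -, hne, -⟩ := hρ
    have hm : (0 : ℝ) ≤ riemannZetaZeroOrder ρ := riemannZetaZeroOrder_nonneg_of_zero hz
    have hγ : 0 < |ρ.im| := abs_pos.2 hne
    rw [norm_mul, Complex.norm_intCast, abs_of_nonneg hm, norm_div,
      Complex.norm_cpow_eq_rpow_re_of_pos hx]
    refine mul_le_mul_of_nonneg_left ?_ hm
    exact div_le_div_of_nonneg_left (Real.rpow_nonneg hx.le _) hγ (Complex.abs_im_le_norm ρ)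
  -- Step 2: conjugate pairs
  have h2 : ∑ ρ ∈ (weilZeroIndex_finite T).toFinset, f ρ = 2 * ∑ ρ ∈ B, f ρ := by
    rw [hW, Finset.sum_union hdisj,
      Finset.sum_image fun a _ b _ h ↦ (starRingEnd ℂ).injective h, two_mul]
    congr 1
    refine Finset.sum_congr rfl fun ρ _ ↦ ?_
    simp only [hf]
    rw [riemannZetaZeroOrder_conj_holds ρ, Complex.conj_re, Complex.conj_im, abs_neg]
  -- Step 3: on the box, `|γ| = γ`, `x^β = x · x^{β−1}`, and every zero has `β < 1`
  have h3 : ∑ ρ ∈ B, f ρ =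
      x * ∑ ρ ∈ (zerosBetween 0 T).filter (fun ρ ↦ 0 ≤ ρ.re ∧ ρ.re < 1),
        (riemannZetaZeroOrder ρ : ℝ) * (x ^ (ρ.re - 1) / ρ.im) := by
    have hfilter : (zerosBetween 0 T).filter (fun ρ ↦ 0 ≤ ρ.re ∧ ρ.re < 1) = B := by
      rw [zerosBetween_zero_eq_toFinset]
      refine Finset.filter_true_of_mem fun ρ hρ ↦ ?_
      rw [Set.Finite.mem_toFinset] at hρ
      obtain ⟨hz, h0, h1, -, -⟩ := hρ
      refine ⟨h0, lt_of_le_of_ne h1 fun h ↦ ?_⟩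
      exact riemannZeta_ne_zero_of_one_le_re (by rw [h]) hz
    rw [hfilter, Finset.mul_sum]
    refine Finset.sum_congr rfl fun ρ hρ ↦ ?_
    rw [hB, Set.Finite.mem_toFinset] at hρ
    obtain ⟨-, -, -, him, -⟩ := hρ
    simp only [hf]
    rw [abs_of_pos him, Real.rpow_sub_one hx.ne']
    field_simp
  unfold FKS2023.zeroSumPsi
  calc ‖zetaZeroSumTrunc x T‖ ≤ ∑ ρ ∈ (weilZeroIndex_finite T).toFinset, f ρ := h1
    _ = 2 * ∑ ρ ∈ B, f ρ := h2
    _ = _ := by rw [h3]; ring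

/-- **The split (3.6)**: `Σ_a^c = Σ_a^b + Σ_b^c` for `a ≤ b ≤ c` (so
`Σ₀¹ = Σ₀^{σ₁} + Σ_{σ₁}^{σ₂} + Σ_{σ₂}^1`). [cite: FioriKadiriSwidinsky2023, §3.2 eq. (3.6)] -/
theorem FKS2023.zeroSumPsi_add {a b c : ℝ} (hab : a ≤ b) (hbc : b ≤ c) (x T : ℝ) :
    FKS2023.zeroSumPsi a b x T + FKS2023.zeroSumPsi b c x T = FKS2023.zeroSumPsi a c x T := by
  classical
  unfold FKS2023.zeroSumPsi
  rw [← mul_add, Finset.sum_filter, Finset.sum_filter, Finset.sum_filter, ← Finset.sum_add_distrib]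
  congr 1
  refine Finset.sum_congr rfl fun ρ _ ↦ ?_
  by_cases hb : ρ.re < b
  · have h2 : ¬ (b ≤ ρ.re ∧ ρ.re < c) := fun h ↦ (not_le.2 hb) h.1
    rw [if_neg h2, add_zero]
    by_cases ha : a ≤ ρ.re
    · rw [if_pos ⟨ha, hb⟩, if_pos ⟨ha, hb.trans_le hbc⟩]
    · rw [if_neg (fun h ↦ ha h.1), if_neg (fun h ↦ ha h.1)]
  · rw [not_lt] at hb
    have h1 : ¬ (a ≤ ρ.re ∧ ρ.re < b) := fun h ↦ (not_lt.2 hb) h.2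
    rw [if_neg h1, zero_add]
    by_cases hc : ρ.re < c
    · rw [if_pos ⟨hb, hc⟩, if_pos ⟨hab.trans hb, hc⟩]
    · rw [if_neg (fun h ↦ hc h.2), if_neg (fun h ↦ hc h.2)]

/-- `Σ_a^b(x,T) ≥ 0`. [cite: FioriKadiriSwidinsky2023, §3.2 eq. (3.5)] -/
theorem FKS2023.zeroSumPsi_nonneg (a b : ℝ) {x : ℝ} (hx : 0 ≤ x) (T : ℝ) :
    0 ≤ FKS2023.zeroSumPsi a b x T := by
  unfold FKS2023.zeroSumPsi
  refine mul_nonneg (by norm_num) (Finset.sum_nonneg fun ρ hρ ↦ ?_)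
  rw [Finset.mem_filter] at hρ
  have hm := zeroOrder_nonneg_of_mem_zerosBetween le_rfl hρ.1
  obtain ⟨-, -, -, him, -⟩ := (mem_zerosBetween le_rfl).1 hρ.1
  have : 0 ≤ x ^ (ρ.re - 1) / ρ.im := div_nonneg (Real.rpow_nonneg hx _) him.le
  positivity

/-! ## Proposition 3.4 in the form (3.3) + (3.6) -/

/-- **FKS Proposition 3.4 with (3.5)–(3.6)** (PROVED from the Cully-Hugill–Johnston Table-4 fact,
as FKS do — Rem. 3.3): for `x > e^{50}` and `3 log x < T < √x/3`,
`|ψ(x) − x| ≤ (Σ₀¹(x,T) + ε₁(x,T)) · x`, `Σ₀¹(x,T) = 2Σ_{0<γ≤T} m(ρ) x^{β−1}/γ`, `ε₁ = 2log²x/T`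
(the printed `Σ_{|γ|<T}|x^{ρ−1}/ρ| + ε₁`, bounded as in (3.6) by `2Σ_{0<γ<T} x^{β−1}/γ`; tree window
`|γ| ≤ T`). [cite: FioriKadiriSwidinsky2023, Prop. 3.4 eqs. (3.3)–(3.6)]
[cite: CullyHugillJohnston2023, Thm. 1.2 and Table 4] -/
theorem FioriKadiriSwidinsky2023_prop34_zeroSumPsi' (hCHJ : CullyHugillJohnston2023_table4')
    {x T : ℝ} (hx : Real.exp 50 < x) (hT : 3 * Real.log x < T) (hT' : T < Real.sqrt x / 3) :
    |ψ x - x| ≤ (FKS2023.zeroSumPsi 0 1 x T + FKS2023.ε₁ x T) * x := by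
  have hx0 : 0 < x := lt_trans (Real.exp_pos 50) hx
  have h1 := hCHJ.dudek_shape hx hT hT'
  have h2 := norm_zetaZeroSumTrunc_le_zeroSumPsi hx0 T
  have e : (FKS2023.zeroSumPsi 0 1 x T + FKS2023.ε₁ x T) * x =
      x * FKS2023.zeroSumPsi 0 1 x T + 2 * x * Real.log x ^ 2 / T := by
    unfold FKS2023.ε₁; ring
  rw [e]
  linarith

/-! ## §4, eq. (4.1) at the point `x` -/

/-- **FKS §4, eq. (4.1) at `x = x₀`** (PROVED; the assembled bound of the proof of Theorem 1.1 at a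
single point): let `x > e^{50}`, `3 log x < T < √x/3`, `5/8 ≤ σ₁ < σ₂ ≤ 1`, `N ≥ 2`, `K ≥ 1`,
`T ≥ H^{(n)}` for all `n < N` and `T ≥ t₀(σ₂, x)`, `(T₀, S₀)` a row of Table 1; assume the
Cully-Hugill–Johnston Table-4 fact, the Table-1 fact, the numerical-RH fact, a zero-free region
`σ ≥ 1 − 1/(R log|t|)` (`|t| ≥ 2`, `R > 0`), an `N(T)` error bound `|N(t) − L(t)| ≤ b₁ log t +
b₂ log log t + b₃` (`t ≥ 2`, `b₁, b₂ ≥ 0`), and a (ZDB) family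
`N(σ,T') ≤ c₁(σ)T'^{p(σ)}(log T')^{q(σ)} + c₂(σ)log²T'` (`T' ≥ H₀`, `0 < p < 1`, `q > 0`) on `[σ₁,σ₂]`.
Then `|ψ(x) − x| ≤ (ε₁(x,T) + ε₂(x,σ₁,T₀,T) + ε₃(x,σ₁,σ₂,N,T) + ε₄(x,σ₂,K,T)) · x`.
[cite: FioriKadiriSwidinsky2023, §4 eq. (4.1) (proof of Thm. 1.1)] -/
theorem FioriKadiriSwidinsky2023_eq41' (hCHJ : CullyHugillJohnston2023_table4')
    (hTab : FioriKadiriSwidinsky2023_table2) (hRH : platt_trudgian_numerical_rh) {R : ℝ} (hR : 0 < R)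
    (hZFR : ∀ σ t : ℝ, 2 ≤ |t| → 1 - 1 / (R * Real.log |t|) ≤ σ → riemannZeta (σ + t * I) ≠ 0)
    {b₁ b₂ b₃ : ℝ} (hb₁ : 0 ≤ b₁) (hb₂ : 0 ≤ b₂)
    (hNT : ∀ t : ℝ, 2 ≤ t → |(zetaZeroCount t : ℝ) - countMain t| ≤ FKS2023.countErr b₁ b₂ b₃ t)
    {T₀ S₀ : ℝ} (hrow : (T₀, S₀) ∈ FKS2023.recipZeroTable2)
    {c₁ c₂ p q : ℝ → ℝ} {σ₁ σ₂ : ℝ} (h58 : 5 / 8 ≤ σ₁) (h12 : σ₁ < σ₂) (hσ₂ : σ₂ ≤ 1)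
    (hpq : ∀ σ ∈ Icc σ₁ σ₂, 0 < p σ ∧ p σ < 1 ∧ 0 < q σ)
    (hZD : ∀ σ ∈ Icc σ₁ σ₂, ∀ T' : ℝ, FKS2023.H₀ ≤ T' →
      (zetaZeroCountRe σ T' : ℝ) ≤ FKS2023.zdbMajorant (c₁ σ) (c₂ σ) (p σ) (q σ) T')
    {N K : ℕ} (hN2 : 2 ≤ N) (hK : 1 ≤ K) {x T : ℝ} (hx : Real.exp 50 < x)
    (hT : 3 * Real.log x < T) (hT' : T < Real.sqrt x / 3)
    (hTH : ∀ n < N, FKS2023.zfrHeight R (FKS2023.sigmaStep σ₁ σ₂ N n) ≤ T)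
    (hTt₀ : FKS2023.t₀ R σ₂ x ≤ T) :
    |ψ x - x| ≤ (FKS2023.ε₁ x T + FKS2023.ε₂ b₁ b₂ b₃ x σ₁ T₀ S₀ T
      + FKS2023.ε₃ c₁ c₂ p q R x σ₁ σ₂ N T
      + FKS2023.ε₄ (c₁ σ₂) (c₂ σ₂) (p σ₂) (q σ₂) R x σ₂ K T) * x := by
  have hx0 : 0 < x := lt_trans (Real.exp_pos 50) hx
  have hx1 : 1 ≤ x := le_trans (by have := Real.add_one_le_exp (50 : ℝ); linarith) hx.le
  have hH₀T : FKS2023.H₀ ≤ T := (FKS2023.H₀_le_t₀ R σ₂ x).trans hTt₀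
  have hσ₁ : 1 / 2 < σ₁ := by linarith
  have hσ₂' : 1 / 2 < σ₂ := by linarith
  -- the three pieces
  have h2 : FKS2023.zeroSumPsi 0 σ₁ x T ≤ FKS2023.ε₂ b₁ b₂ b₃ x σ₁ T₀ S₀ T :=
    FioriKadiriSwidinsky2023_prop32 hTab hRH hb₁ hb₂ hNT hrow hσ₁ (h12.le.trans hσ₂) hx1 hH₀T
  have h3 : FKS2023.zeroSumPsi σ₁ σ₂ x T ≤ FKS2023.ε₃ c₁ c₂ p q R x σ₁ σ₂ N T :=
    FioriKadiriSwidinsky2023_prop33 hRH hR hZFR h58 h12 hσ₂ hpq hZD hN2 hx1 hTH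
  have h4 : FKS2023.zeroSumPsi σ₂ 1 x T ≤
      FKS2023.ε₄ (c₁ σ₂) (c₂ σ₂) (p σ₂) (q σ₂) R x σ₂ K T :=
    FioriKadiriSwidinsky2023_cor312 hRH hR hZFR hσ₂' (hZD σ₂ ⟨h12.le, le_rfl⟩) hK hx1 hTt₀
  -- the split (3.6) and Prop. 3.4
  have hsplit : FKS2023.zeroSumPsi 0 1 x T = FKS2023.zeroSumPsi 0 σ₁ x T
      + FKS2023.zeroSumPsi σ₁ σ₂ x T + FKS2023.zeroSumPsi σ₂ 1 x T := by
    rw [FKS2023.zeroSumPsi_add (by linarith) h12.le, FKS2023.zeroSumPsi_add (by linarith) hσ₂]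
  have h1 := FioriKadiriSwidinsky2023_prop34_zeroSumPsi' hCHJ hx hT hT'
  rw [hsplit] at h1
  refine h1.trans (mul_le_mul_of_nonneg_right ?_ hx0.le)
  linarith

end Literature.NumberTheory.LFunctions
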